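import Literature.AlgebraicTopology.SingularHomology.TransverseDiscFunctionalRelative
import Literature.AlgebraicTopology.SingularHomology.LocalDegreeLinearization
import HarnessLib

/-!
# Model classes of Euclidean models: restriction to a sub-domain, and precomposition with a linear
# map (Hatcher 2002, §3.3: local degree `= sign det`; for Milnor 1965, proof of Thm. 7.6, PDF p. 52)

Topic `Literature/Topology/FourManifolds`; a brick for the one-slide step of Milnor's Basis
Theorem 7.6 on a slab (`Literature.Topology.FourManifolds.Cobordism.Milnor1965_basisTheorem_slab_of_slideStep`,
`HCobordismBasisInduction.lean`).  The sign of the slide (Milnor, *Lectures on the h-cobordism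
theorem* (1965), PDF p. 52) is compared between the two dockings `ρ` and `r ≫ ρ` through the
*model classes* `(U ⊆ T)⁎ (e)⁎ g_c ∈ Hₖ(T | e c)` of Euclidean models `e : V ≃ U ⊆ T` (the
reference classes of `Literature.AlgebraicTopology.SingularHomology.TransverseDiscDatum.functional_map_eq_smul_of_single`
and of `Literature.Topology.FourManifolds.exists_units_relLocalFamily_eq_smul_model`).  Two
bookkeeping facts about them:

* `map_subsetInclusion_openSubsetIso_inv_localClass` — the excised model class of an open
  `V' ⊆ V` maps to that of `V` under the inclusion;
* **`map_id_modelClass_eq_of_restrict`** — restricting a model to an open sub-domain does not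
  change its model class (naturality of `localHomology.xEquiv`, `relativeSingularHomology.xEquiv_map`);
* **`map_id_modelClass_eq_sign_smul_of_comp_linear`** — if `e₂ = e₁ ∘ M` for a linear
  automorphism `M` of `ℝᵏ`, the model class of `e₂` at `c` is `sign(det M)` times the model class
  of `e₁` at `M c` (the local degree of `M`,
  `Literature.AlgebraicTopology.SingularHomology.HomologicalOrientation.localDegree_of_hasFDerivAt`);
  for the slide: the band charts of the two dockings differ near the top of the band by the
  reflection `r` of the sheet coordinate, `det = -1`.

Everything here is proved; no definitions, no named facts.

## References

* A. Hatcher, *Algebraic Topology*, CUP 2002, §3.3 pp. 233–236, Thm. 2.20. [HatcherAT2002]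
* J. Milnor, *Lectures on the h-cobordism theorem*, Princeton Mathematical Notes (1965),
  Lemma 7.7 and completion of the proof of Thm. 7.6 (PDF pp. 51–52).  Held:
  `lit read book:milnornd-lectures-h-cobordism-theorem`. [MilnorHCobordism1965]
-/

noncomputable section

open CategoryTheory Set Function Filter Topology
open Literature.AlgebraicTopology.SingularHomology

universe u

namespace Literature.Topology.FourManifolds

/-- **The excised model classes are compatible with the inclusion of an open sub-domain**:
for `V' ⊆ V` open in `ℝᵏ` and `v ∈ V'`, the inclusion `V' → V` maps `g_v` read in `Hₖ(V' | v)` to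
`g_v` read in `Hₖ(V | v)`. [cite: HatcherAT2002, Thm. 2.20] -/
theorem map_subsetInclusion_openSubsetIso_inv_localClass {k : ℕ}
    (gE : HomologicalOrientation ℤ (EuclideanSpace ℝ (Fin k)) k)
    {V V' : Set (EuclideanSpace ℝ (Fin k))} (hV : IsOpen V) (hV' : IsOpen V') (hV'V : V' ⊆ V)
    (v : ↥V')
    (h : MapsTo (subsetInclusion hV'V) ({v}ᶜ : Set ↥V') ({(⟨v.1, hV'V v.2⟩ : ↥V)}ᶜ : Set ↥V)) :
    relativeSingularHomology.map ℤ ℤ (subsetInclusion hV'V) h k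
        ((localHomology.openSubsetIso ℤ ℤ hV' v.2 k).inv (gE.localClass (v : EuclideanSpace ℝ (Fin k)))) =
      (localHomology.openSubsetIso ℤ ℤ hV (hV'V v.2) k).inv (gE.localClass (v : EuclideanSpace ℝ (Fin k))) := by
  -- compare after the excision isomorphism of `V`
  have hinj : Function.Injective (localHomology.openSubsetIso ℤ ℤ hV (hV'V v.2) k).hom :=
    (localHomology.openSubsetIso ℤ ℤ hV (hV'V v.2) k).toLinearEquiv.injective
  apply hinj
  rw [Iso.inv_hom_id_apply]
  change (relativeSingularHomology.map ℤ ℤ (subsetInclusion hV'V) h k ≫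
    relativeSingularHomology.map ℤ ℤ (subsetIncl V) (localHomology.mapsTo_subsetIncl_compl (hV'V v.2)) k) _ = _
  rw [← relativeSingularHomology.map_comp]
  have hcomp : (subsetIncl V).comp (subsetInclusion hV'V) = subsetIncl V' := by ext w; rfl
  rw [relativeSingularHomology.map_congr ℤ ℤ hcomp _ (localHomology.mapsTo_subsetIncl_compl v.2) k]
  change (localHomology.openSubsetIso ℤ ℤ hV' v.2 k).hom
    ((localHomology.openSubsetIso ℤ ℤ hV' v.2 k).inv (gE.localClass (v : EuclideanSpace ℝ (Fin k)))) = _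
  rw [Iso.inv_hom_id_apply]

/-- **Restricting a Euclidean model to an open sub-domain does not change its model classes.**
For `e : V ≃ U ⊆ T` and `e' : V' ≃ U' ⊆ T` with `V' ⊆ V` open and `e' v = e v` for `v ∈ V'`:
`(U ⊆ T)⁎ (e)⁎ g_v = (U' ⊆ T)⁎ (e')⁎ g_v` in `Hₖ(T | e v)` (up to the transport along the identity
between the two spellings of the point). [cite: HatcherAT2002, §3.3 p. 233, Thm. 2.20] -/
theorem map_id_modelClass_eq_of_restrict {k : ℕ} {T : Type u} [TopologicalSpace T]
    (gE : HomologicalOrientation ℤ (EuclideanSpace ℝ (Fin k)) k)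
    {V V' : Set (EuclideanSpace ℝ (Fin k))} (hV : IsOpen V) (hV' : IsOpen V') (hV'V : V' ⊆ V)
    {U U' : Set T} (e : ↥V ≃ₜ ↥U) (e' : ↥V' ≃ₜ ↥U')
    (he' : ∀ v : ↥V', ((e' v : ↥U') : T) = ((e ⟨v.1, hV'V v.2⟩ : ↥U) : T)) (v : ↥V')
    (hid : MapsTo (ContinuousMap.id T) ({((e ⟨v.1, hV'V v.2⟩ : ↥U) : T)}ᶜ : Set T)
      ({((e' v : ↥U') : T)}ᶜ : Set T)) :
    relativeSingularHomology.map ℤ ℤ (ContinuousMap.id T) hid k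
        (relativeSingularHomology.map ℤ ℤ (subsetIncl U)
          (localHomology.mapsTo_subsetIncl_compl (e ⟨v.1, hV'V v.2⟩).2) k
          (localHomology.xEquiv ℤ ℤ e ⟨v.1, hV'V v.2⟩ k
            ((localHomology.openSubsetIso ℤ ℤ hV (hV'V v.2) k).inv
              (gE.localClass (v : EuclideanSpace ℝ (Fin k)))))) =
      relativeSingularHomology.map ℤ ℤ (subsetIncl U')
        (localHomology.mapsTo_subsetIncl_compl (e' v).2) k
        (localHomology.xEquiv ℤ ℤ e' v k
          ((localHomology.openSubsetIso ℤ ℤ hV' v.2 k).inv (gE.localClass (v : EuclideanSpace ℝ (Fin k))))) := by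
  -- the square `g ∘ e' = e ∘ f` with the inclusions `f : V' → V`, `g : U' → U`
  have hU'U : ∀ u : ↥U', (u : T) ∈ U := fun u => by
    have h := he' (e'.symm u)
    rw [e'.apply_symm_apply] at h
    rw [h]; exact (e _).2
  set f : C(↥V', ↥V) := ⟨subsetInclusion hV'V, continuous_inclusion hV'V⟩ with hf
  set g : C(↥U', ↥U) := ⟨fun u => ⟨u.1, hU'U u⟩, by fun_prop⟩ with hg
  have hsq : ∀ x : ↥V', g (e' x) = e (f x) := fun x => Subtype.ext (he' x)
  have hfm : MapsTo f ({v}ᶜ : Set ↥V') ({(⟨v.1, hV'V v.2⟩ : ↥V)}ᶜ : Set ↥V) := by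
    intro w hw h
    apply hw
    rw [mem_singleton_iff] at h ⊢
    have h' : (w : EuclideanSpace ℝ (Fin k)) = v := by
      have := congrArg Subtype.val h
      exact this
    exact Subtype.ext h'
  have hgm : MapsTo g ({e' v}ᶜ : Set ↥U') ({e ⟨v.1, hV'V v.2⟩}ᶜ : Set ↥U) := by
    intro u hu h
    apply hu
    rw [mem_singleton_iff] at h ⊢
    apply e'.symm.injective
    rw [e'.symm_apply_apply]
    have h1 : g u = g (e' v) := by rw [hsq v]; exact h
    have h2 : u = e' v := by
      apply Subtype.ext
      exact congrArg (fun w : ↥U => (w : T)) h1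
    rw [h2, e'.symm_apply_apply]
  have nat := relativeSingularHomology.xEquiv_map ℤ ℤ e' e f g hsq
    (mapsTo_compl_singleton e'.toEquiv v) (mapsTo_symm_compl_singleton e'.toEquiv v)
    (mapsTo_compl_singleton e.toEquiv (f v)) (mapsTo_symm_compl_singleton e.toEquiv (f v)) hfm hgm k
    ((localHomology.openSubsetIso ℤ ℤ hV' v.2 k).inv (gE.localClass (v : EuclideanSpace ℝ (Fin k))))
  -- `f⁎` of the excised class of `V'` is the excised class of `V`
  have hfclass : relativeSingularHomology.map ℤ ℤ f hfm k
      ((localHomology.openSubsetIso ℤ ℤ hV' v.2 k).inv (gE.localClass (v : EuclideanSpace ℝ (Fin k)))) =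
      (localHomology.openSubsetIso ℤ ℤ hV (hV'V v.2) k).inv (gE.localClass (v : EuclideanSpace ℝ (Fin k))) :=
    map_subsetInclusion_openSubsetIso_inv_localClass gE hV hV' hV'V v hfm
  change localHomology.xEquiv ℤ ℤ e (f v) k _ = _ at nat
  have key : localHomology.xEquiv ℤ ℤ e (f v) k
      ((localHomology.openSubsetIso ℤ ℤ hV (hV'V v.2) k).inv (gE.localClass (v : EuclideanSpace ℝ (Fin k)))) =
      relativeSingularHomology.map ℤ ℤ g hgm k (localHomology.xEquiv ℤ ℤ e' v k
        ((localHomology.openSubsetIso ℤ ℤ hV' v.2 k).inv (gE.localClass (v : EuclideanSpace ℝ (Fin k))))) := by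
    rw [← hfclass]; exact nat
  -- push into `T`: `(U ⊆ T) ∘ g = (U' ⊆ T)`
  change relativeSingularHomology.map ℤ ℤ (ContinuousMap.id T) hid k
    (relativeSingularHomology.map ℤ ℤ (subsetIncl U)
      (localHomology.mapsTo_subsetIncl_compl (e (f v)).2) k
      (localHomology.xEquiv ℤ ℤ e (f v) k
        ((localHomology.openSubsetIso ℤ ℤ hV (hV'V v.2) k).inv (gE.localClass (v : EuclideanSpace ℝ (Fin k)))))) = _
  rw [key, ← ModuleCat.comp_apply, ← ModuleCat.comp_apply, ← relativeSingularHomology.map_comp,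
    ← relativeSingularHomology.map_comp]
  rfl

/-- **Precomposing a Euclidean model with a linear automorphism multiplies its model classes by
`sign(det)`.**  Let `e₁ : V₁ ≃ U₁`, `e₂ : V₂ ≃ U₂` be models in `T` (`V₁, V₂ ⊆ ℝᵏ` open) and `M` a
linear map of `ℝᵏ` with `det M ≠ 0`, `M(V₂) ⊆ V₁` and `e₂ v = e₁ (M v)` for all `v ∈ V₂`.  Then for
`c ∈ V₂`: `(U₂ ⊆ T)⁎ (e₂)⁎ g_c = sign(det M) • (U₁ ⊆ T)⁎ (e₁)⁎ g_{M c}` in `Hₖ(T | ·)` — the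
local degree of `M` (Hatcher 2002, §3.3; the tree's `localDegree_of_hasFDerivAt`).  For the slide
step `M` is the reflection of the sheet coordinate relating the band charts of the two dockings,
`det M = -1`. [cite: HatcherAT2002, §3.3 pp. 233–236; MilnorHCobordism1965, Lemma 7.7 (PDF p. 51)] -/
theorem map_id_modelClass_eq_sign_smul_of_comp_linear {k : ℕ} {T : Type u} [TopologicalSpace T]
    (gE : HomologicalOrientation ℤ (EuclideanSpace ℝ (Fin k)) k)
    {V₁ V₂ : Set (EuclideanSpace ℝ (Fin k))} (hV₁ : IsOpen V₁) (hV₂ : IsOpen V₂)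
    {U₁ U₂ : Set T} (e₁ : ↥V₁ ≃ₜ ↥U₁) (e₂ : ↥V₂ ≃ₜ ↥U₂)
    (M : EuclideanSpace ℝ (Fin k) →L[ℝ] EuclideanSpace ℝ (Fin k))
    (hM : LinearMap.det (M : EuclideanSpace ℝ (Fin k) →ₗ[ℝ] EuclideanSpace ℝ (Fin k)) ≠ 0)
    (hMV : ∀ v : ↥V₂, M v ∈ V₁)
    (hcomp : ∀ v : ↥V₂, ((e₂ v : ↥U₂) : T) = ((e₁ ⟨M v, hMV v⟩ : ↥U₁) : T)) (c : ↥V₂)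
    (hid : MapsTo (ContinuousMap.id T) ({((e₂ c : ↥U₂) : T)}ᶜ : Set T)
      ({((e₁ ⟨M c, hMV c⟩ : ↥U₁) : T)}ᶜ : Set T)) :
    relativeSingularHomology.map ℤ ℤ (ContinuousMap.id T) hid k
        (relativeSingularHomology.map ℤ ℤ (subsetIncl U₂)
          (localHomology.mapsTo_subsetIncl_compl (e₂ c).2) k
          (localHomology.xEquiv ℤ ℤ e₂ c k
            ((localHomology.openSubsetIso ℤ ℤ hV₂ c.2 k).inv (gE.localClass (c : EuclideanSpace ℝ (Fin k)))))) =
      ((SignType.sign (LinearMap.det (M : EuclideanSpace ℝ (Fin k) →ₗ[ℝ] EuclideanSpace ℝ (Fin k)))) : ℤ) •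
        relativeSingularHomology.map ℤ ℤ (subsetIncl U₁)
          (localHomology.mapsTo_subsetIncl_compl (e₁ ⟨M c, hMV c⟩).2) k
          (localHomology.xEquiv ℤ ℤ e₁ ⟨M c, hMV c⟩ k
            ((localHomology.openSubsetIso ℤ ℤ hV₁ (hMV c) k).inv
              (gE.localClass (M c : EuclideanSpace ℝ (Fin k))))) := by
  -- the square `g ∘ e₂ = e₁ ∘ f` with `f = M|V₂ : V₂ → V₁` and `g : U₂ → U₁`
  have hU₂U₁ : ∀ u : ↥U₂, (u : T) ∈ U₁ := fun u => by
    have h := hcomp (e₂.symm u)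
    rw [e₂.apply_symm_apply] at h
    rw [h]; exact (e₁ _).2
  set f : C(↥V₂, ↥V₁) := ⟨fun v => ⟨M v, hMV v⟩, by fun_prop⟩ with hf
  set g : C(↥U₂, ↥U₁) := ⟨fun u => ⟨u.1, hU₂U₁ u⟩, by fun_prop⟩ with hg
  have hsq : ∀ x : ↥V₂, g (e₂ x) = e₁ (f x) := fun x => Subtype.ext (hcomp x)
  have hMinj : Function.Injective M := by
    have hunit : IsUnit (M : EuclideanSpace ℝ (Fin k) →ₗ[ℝ] EuclideanSpace ℝ (Fin k)) :=
      (LinearMap.isUnit_iff_isUnit_det _).2 (Ne.isUnit hM)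
    exact LinearMap.ker_eq_bot.1 ((LinearMap.isUnit_iff_ker_eq_bot _).1 hunit)
  have hfm : MapsTo f ({c}ᶜ : Set ↥V₂) ({(⟨M c, hMV c⟩ : ↥V₁)}ᶜ : Set ↥V₁) := by
    intro w hw h
    apply hw
    rw [mem_singleton_iff] at h ⊢
    exact Subtype.ext (hMinj (congrArg Subtype.val h))
  have hgm : MapsTo g ({e₂ c}ᶜ : Set ↥U₂) ({e₁ ⟨M c, hMV c⟩}ᶜ : Set ↥U₁) := by
    intro u hu h
    apply hu
    rw [mem_singleton_iff] at h ⊢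
    apply e₂.symm.injective
    rw [e₂.symm_apply_apply]
    have h1 : g u = g (e₂ c) := by rw [hsq c]; exact h
    have h2 : u = e₂ c := Subtype.ext (congrArg (fun w : ↥U₁ => (w : T)) h1)
    rw [h2, e₂.symm_apply_apply]
  have nat := relativeSingularHomology.xEquiv_map ℤ ℤ e₂ e₁ f g hsq
    (mapsTo_compl_singleton e₂.toEquiv c) (mapsTo_symm_compl_singleton e₂.toEquiv c)
    (mapsTo_compl_singleton e₁.toEquiv (f c)) (mapsTo_symm_compl_singleton e₁.toEquiv (f c)) hfm hgm k
    ((localHomology.openSubsetIso ℤ ℤ hV₂ c.2 k).inv (gE.localClass (c : EuclideanSpace ℝ (Fin k))))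
  -- `f⁎` of the excised class: the local degree of `M`
  have hfclass : relativeSingularHomology.map ℤ ℤ f hfm k
      ((localHomology.openSubsetIso ℤ ℤ hV₂ c.2 k).inv (gE.localClass (c : EuclideanSpace ℝ (Fin k)))) =
      ((SignType.sign (LinearMap.det (M : EuclideanSpace ℝ (Fin k) →ₗ[ℝ] EuclideanSpace ℝ (Fin k)))) : ℤ) •
        (localHomology.openSubsetIso ℤ ℤ hV₁ (hMV c) k).inv
          (gE.localClass (M c : EuclideanSpace ℝ (Fin k))) := by
    have hinj : Function.Injective (localHomology.openSubsetIso ℤ ℤ hV₁ (hMV c) k).hom :=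
      (localHomology.openSubsetIso ℤ ℤ hV₁ (hMV c) k).toLinearEquiv.injective
    apply hinj
    rw [map_zsmul, Iso.inv_hom_id_apply]
    change (relativeSingularHomology.map ℤ ℤ f hfm k ≫
      relativeSingularHomology.map ℤ ℤ (subsetIncl V₁) (localHomology.mapsTo_subsetIncl_compl (hMV c)) k) _ = _
    rw [← relativeSingularHomology.map_comp]
    -- the composite `V₂ → ℝᵏ` is `M|V₂`
    have htc : ContinuousOn (fun v : EuclideanSpace ℝ (Fin k) => M v) V₂ := M.continuous.continuousOn
    have hmaps : MapsTo (fun v : ↥V₂ => M v) ({c}ᶜ : Set ↥V₂) ({M c}ᶜ : Set _) := by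
      intro w hw h
      apply hw
      rw [mem_singleton_iff] at h ⊢
      exact Subtype.ext (hMinj h)
    have hcmp : (subsetIncl V₁).comp f = (⟨fun v : ↥V₂ => M v, htc.restrict⟩ : C(↥V₂, EuclideanSpace ℝ (Fin k))) := by
      ext v; rfl
    rw [relativeSingularHomology.map_congr ℤ ℤ hcmp _ hmaps k,
      gE.localDegree_of_hasFDerivAt (fun v => M v) hV₂ c.2 htc M.hasFDerivAt hM rfl hmaps,
      sign_smul_eq_ite hM]
  change localHomology.xEquiv ℤ ℤ e₁ (f c) k _ = _ at nat
  rw [hfclass, map_zsmul] at nat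
  -- push into `T`
  have h1 : relativeSingularHomology.map ℤ ℤ (ContinuousMap.id T) hid k
      (relativeSingularHomology.map ℤ ℤ (subsetIncl U₂) (localHomology.mapsTo_subsetIncl_compl (e₂ c).2) k
        (localHomology.xEquiv ℤ ℤ e₂ c k
          ((localHomology.openSubsetIso ℤ ℤ hV₂ c.2 k).inv (gE.localClass (c : EuclideanSpace ℝ (Fin k)))))) =
      relativeSingularHomology.map ℤ ℤ (subsetIncl U₁) (localHomology.mapsTo_subsetIncl_compl (e₁ (f c)).2) k
        (relativeSingularHomology.map ℤ ℤ g hgm k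
          (localHomology.xEquiv ℤ ℤ e₂ c k
            ((localHomology.openSubsetIso ℤ ℤ hV₂ c.2 k).inv (gE.localClass (c : EuclideanSpace ℝ (Fin k)))))) := by
    rw [← ModuleCat.comp_apply, ← ModuleCat.comp_apply, ← relativeSingularHomology.map_comp,
      ← relativeSingularHomology.map_comp]
    rfl
  rw [h1]
  have nat' : relativeSingularHomology.map ℤ ℤ g hgm k (localHomology.xEquiv ℤ ℤ e₂ c k
      ((localHomology.openSubsetIso ℤ ℤ hV₂ c.2 k).inv (gE.localClass (c : EuclideanSpace ℝ (Fin k))))) =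
      ((SignType.sign (LinearMap.det (M : EuclideanSpace ℝ (Fin k) →ₗ[ℝ] EuclideanSpace ℝ (Fin k)))) : ℤ) •
        localHomology.xEquiv ℤ ℤ e₁ (f c) k
          ((localHomology.openSubsetIso ℤ ℤ hV₁ (hMV c) k).inv (gE.localClass (M c : EuclideanSpace ℝ (Fin k)))) :=
    nat.symm
  rw [nat', map_zsmul]
  rfl

end Literature.Topology.FourManifolds

end
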